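import Summits.CriticalPhenomena.Ising3DConformalLimit.Theses.BallSpecification
import Literature.Probability.LatticeModels.MoebiusWeightedAction
import Summits.CriticalPhenomena.Ising3DConformalLimit.Theorems.InversionUpgradeNormalised.Negative.AutomaticOrders
import Summits.CriticalPhenomena.Ising3DConformalLimit.Theorems.PrecisionLaplacianMoebiusLimitOfTwoPointLawSphereInversionCoV
import Summits.CriticalPhenomena.Ising3DConformalLimit.Theorems.MarkovRigidityFieldRealisationClusterLimit
import HarnessLib

/-!
# Stub `stub_lowOrderClass` of line `birth` (skeleton r2) for crux `BallSpecifiedInversionUpgrade` (stmt-CriticalPhenomena-11248)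

Route `route-CriticalPhenomena-BallSpecification`, sub-problem `Ising3DConformalLimit`.  Target tree file:
`Summits/CriticalPhenomena/Ising3DConformalLimit/Theorems/BallSpecificationBallSpecifiedInversionUpgradeLowOrderClass.lean`,
landed with `--supports stmt-CriticalPhenomena-11248` (the theorem name and statement below are the REGISTERED stub; do not change them).

## Content (the `n ≤ 2` shadow of the crux antecedent `H`)

Under `H` (only the clauses `hρ`, `hlim`, `hnorm`, `hnd`, `heuc`, `hsc`, `hmomS` are used):

* (b) `∫ ω f dμ = 0` for every test function: `moment μ 1 ![f] = ∫ S 1 x · f`, and `S 1 ≡ 0`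
  (`InversionUpgradeNormalisedNegative.limit_odd_eq_zero`).
* (c) `∫ (ω (ι^*_Δ f))² dμ = ∫ (ω f)² dμ` for `f` compactly supported off `0`: both sides are
  `∫ S 2 x ∏ᵢ φ(xᵢ) dx` (`HasMomentDensity` at `n = 2`), and the two configuration-space integrals agree
  by the change of variables `PrecisionLaplacianMoebiusLimitOfTwoPointLaw.integral_sphereInversion_transfer`
  (`λ = 1`) together with the pointwise two-point inversion law `invIdentity_two` — no integrability needed.
* (a) `ω ↦ ω f ∈ L²(μ)` for compactly supported `f`: the two-point function is explicitly
  `S 2 x = κ ‖x₀ - x₁‖^{-2Δ}` off the diagonal (`two_point_eq`, `κ > 0` by non-degeneracy), `0` on it;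
  with the Schwartz decay `|g(p)| ≤ B (1+‖p‖)^{-4}` and `Δ ≤ 1` (`delta_mem_Icc_of_hyp`) the integrand
  `S 2 x g(x₀) g(x₁)` is dominated by the integrable shifted kernel of
  `MarkovRigidityFieldRealisation.integrable_weight_shift_kernel`; for `0 ≤ g ≢ 0` the integral is
  `> 0`, so the Bochner integral `∫ (ω g)² dμ = ∫ S 2 g⊗g` is genuine and `ω g ∈ L²`; a general compactly
  supported `f` is `(f + c•G) - c•G` with `G` a `ContDiffBump` equal to `1` on `tsupport f`.

References: Glimm–Jaffe, *Quantum Physics* (1987) §6.1; Di Francesco–Mathieu–Sénéchal (1997) §4.3.1.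
Theorem-only file (no definitions).
-/

noncomputable section

namespace Summit.CriticalPhenomena.Ising3DConformalLimit.BallSpecificationBallSpecifiedInversionUpgrade

open MeasureTheory
open Literature.Probability.LatticeModels Literature.MathematicalPhysics.QuantumLattice
open Summit.CriticalPhenomena.Ising3DConformalLimit.InversionUpgradeNormalisedNegative
open Summit.CriticalPhenomena.Ising3DConformalLimit.PrecisionLaplacianMoebiusLimitOfTwoPointLaw
open Summit.CriticalPhenomena.Ising3DConformalLimit.MarkovRigidityFieldRealisation
open Summit.CriticalPhenomena.Ising3DConformalLimit.Theorems.MoebiusLimitOfTwoPointLaw.Negative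
  (sphereInversion_eq_smul_inversion)

/-! ### The explicit two-point function and integrability against test functions -/

/-- MODEL-BLIND explicit two-point function: `S 2 x = κ ‖x₀ - x₁‖^{-2Δ}` off the diagonal
(`two_point_eq`), `0` on it (normalisation `hnorm`), `κ = S₂(0, e₀)`. [cite: FrancescoMathieuSenechal1997, §4.3.1] -/
theorem lowOrderClass_two_point_formula {Δ : ℝ} {S : CorrFamily 3}
    (hnorm : ∀ n z, z ∉ NonCoincident 3 n → S n z = 0)
    (heuc : IsEuclideanInvariant S) (hsc : IsScaleCovariant Δ S)
    (x : Fin 2 → EuclideanSpace ℝ (Fin 3)) :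
    S 2 x = if x 0 = x 1 then 0
      else S 2 ![0, EuclideanSpace.single 0 1] * ‖x 0 - x 1‖ ^ (-(2 * Δ)) := by
  split_ifs with h
  · refine hnorm 2 x fun hinj => ?_
    exact absurd (hinj h) (by decide)
  · have hx2 : x = ![x 0, x 1] := by
      funext i; fin_cases i <;> rfl
    conv_lhs => rw [hx2]
    rw [two_point_eq heuc hsc h, mul_comm]

/-- The two-point function of a normalised Euclidean-invariant scale-covariant family is (Borel)
measurable on `(ℝ³)²` (it is an explicit function of `x₀ - x₁`). [folklore] -/
theorem lowOrderClass_measurable_two {Δ : ℝ} {S : CorrFamily 3}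
    (hnorm : ∀ n z, z ∉ NonCoincident 3 n → S n z = 0)
    (heuc : IsEuclideanInvariant S) (hsc : IsScaleCovariant Δ S) :
    Measurable (S 2) := by
  have h : S 2 = fun x => if x 0 = x 1 then 0
      else S 2 ![0, EuclideanSpace.single 0 1] * ‖x 0 - x 1‖ ^ (-(2 * Δ)) :=
    funext (lowOrderClass_two_point_formula hnorm heuc hsc)
  rw [h]
  refine Measurable.ite ((isClosed_eq (continuous_apply 0) (continuous_apply 1)).measurableSet)
    measurable_const ?_
  exact (((measurable_pi_apply 0).sub (measurable_pi_apply 1)).norm.pow_const _).const_mul _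

/-- **Integrability of the smeared two-point integrand.** For `0 ≤ Δ ≤ 1`, `κ ≥ 0` and a test
function `g`, `x ↦ S 2 x · g(x₀) g(x₁)` is integrable on `(ℝ³)²`: it is dominated by
`κ B² (1+‖x₀‖)^{-4} (1+‖x₁‖)^{-4} max(1, ‖x₁-x₀‖^{-2Δ})` (Schwartz decay and the locally integrable
Riesz kernel, `2Δ < 3`). [cite: GlimmJaffe1987, §6.1] -/
theorem lowOrderClass_integrable_two {Δ : ℝ} {S : CorrFamily 3}
    (hnorm : ∀ n z, z ∉ NonCoincident 3 n → S n z = 0)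
    (heuc : IsEuclideanInvariant S) (hsc : IsScaleCovariant Δ S)
    (hΔ0 : 0 ≤ Δ) (hΔ1 : Δ ≤ 1) (hκ : 0 ≤ S 2 ![0, EuclideanSpace.single 0 1])
    (g : SchwartzMap (EuclideanSpace ℝ (Fin 3)) ℝ) :
    Integrable (fun x : Fin 2 → EuclideanSpace ℝ (Fin 3) => S 2 x * ∏ i, g (x i)) := by
  set κ : ℝ := S 2 ![0, EuclideanSpace.single 0 1] with hκdef
  set B : ℝ := 2 ^ 4 * ((Finset.Iic ((4, 0) : ℕ × ℕ)).sup
    (schwartzSeminormFamily ℝ (EuclideanSpace ℝ (Fin 3)) ℝ)) g with hB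
  have hB0 : 0 ≤ B := by positivity
  have hgB : ∀ p, |g p| ≤ B * (1 + ‖p‖) ^ (-(4 : ℝ)) := abs_le_seminorm_mul_weight g
  have hdom := (integrable_weight_shift_kernel (a := 2 * Δ) (by positivity) (by linarith)
    (0 : EuclideanSpace ℝ (Fin 3))).const_mul (κ * B ^ 2)
  refine hdom.mono' ?_ (Filter.Eventually.of_forall fun x => ?_)
  · refine ((lowOrderClass_measurable_two hnorm heuc hsc).mul ?_).aestronglyMeasurable
    exact Finset.measurable_prod _ fun i _ => g.continuous.measurable.comp (measurable_pi_apply i)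
  · rw [Fin.prod_univ_two, Real.norm_eq_abs, abs_mul, abs_mul, sub_zero]
    have hmax0 : 0 ≤ max 1 (‖x 1 - x 0‖ ^ (-(2 * Δ))) := le_trans zero_le_one (le_max_left _ _)
    have hA : 0 ≤ κ * max 1 (‖x 1 - x 0‖ ^ (-(2 * Δ))) := mul_nonneg hκ hmax0
    have hS : |S 2 x| ≤ κ * max 1 (‖x 1 - x 0‖ ^ (-(2 * Δ))) := by
      rw [lowOrderClass_two_point_formula hnorm heuc hsc x]
      split_ifs with h
      · rw [abs_zero]; exact hA
      · rw [abs_of_nonneg (mul_nonneg hκ (Real.rpow_nonneg (norm_nonneg _) _)), norm_sub_rev]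
        exact mul_le_mul_of_nonneg_left (le_max_right _ _) hκ
    calc |S 2 x| * (|g (x 0)| * |g (x 1)|)
        ≤ (κ * max 1 (‖x 1 - x 0‖ ^ (-(2 * Δ)))) *
            ((B * (1 + ‖x 0‖) ^ (-(4 : ℝ))) * (B * (1 + ‖x 1‖) ^ (-(4 : ℝ)))) :=
          mul_le_mul hS (mul_le_mul (hgB (x 0)) (hgB (x 1)) (abs_nonneg _)
            (mul_nonneg hB0 (weight_nonneg _ _))) (mul_nonneg (abs_nonneg _) (abs_nonneg _)) hA
      _ = κ * B ^ 2 * ((1 + ‖x 0‖) ^ (-(4 : ℝ)) * (1 + ‖x 1‖) ^ (-(4 : ℝ)) *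
            max 1 (‖x 1 - x 0‖ ^ (-(2 * Δ)))) := by ring

/-- **Strict positivity of the smeared two-point integral** for `0 ≤ g ≢ 0`:
`0 < ∫ S 2 x g(x₀) g(x₁) dx` (the integrand is nonnegative, integrable, and positive on the open
non-empty set `{x₀ ≠ x₁, g(x₀) > 0, g(x₁) > 0}`). [cite: GlimmJaffe1987, §6.1] -/
theorem lowOrderClass_integral_pos {Δ : ℝ} {S : CorrFamily 3}
    (hnorm : ∀ n z, z ∉ NonCoincident 3 n → S n z = 0)
    (heuc : IsEuclideanInvariant S) (hsc : IsScaleCovariant Δ S)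
    (hΔ0 : 0 ≤ Δ) (hΔ1 : Δ ≤ 1) (hκ : 0 < S 2 ![0, EuclideanSpace.single 0 1])
    {g : SchwartzMap (EuclideanSpace ℝ (Fin 3)) ℝ} (hg0 : ∀ p, 0 ≤ g p)
    {p₀ : EuclideanSpace ℝ (Fin 3)} (hp₀ : g p₀ ≠ 0) :
    0 < ∫ x : Fin 2 → EuclideanSpace ℝ (Fin 3), S 2 x * ∏ i, g (x i) := by
  have hS0 : ∀ x, 0 ≤ S 2 x := fun x => by
    rw [lowOrderClass_two_point_formula hnorm heuc hsc x]
    split_ifs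
    · exact le_rfl
    · exact mul_nonneg hκ.le (Real.rpow_nonneg (norm_nonneg _) _)
  have hF0 : 0 ≤ fun x : Fin 2 → EuclideanSpace ℝ (Fin 3) => S 2 x * ∏ i, g (x i) := fun x =>
    mul_nonneg (hS0 x) (Finset.prod_nonneg fun i _ => hg0 _)
  rw [integral_pos_iff_support_of_nonneg hF0
    (lowOrderClass_integrable_two hnorm heuc hsc hΔ0 hΔ1 hκ.le g)]
  -- two distinct points where `g > 0`
  have hp₀' : 0 < g p₀ := lt_of_le_of_ne (hg0 p₀) (Ne.symm hp₀)
  have hUo : IsOpen {p : EuclideanSpace ℝ (Fin 3) | 0 < g p} := isOpen_lt continuous_const g.continuous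
  obtain ⟨ε, hε, hball⟩ := Metric.isOpen_iff.1 hUo p₀ hp₀'
  obtain ⟨q, hq⟩ := (NormedSpace.sphere_nonempty (x := p₀) (r := ε / 2)).2 (by positivity)
  rw [Metric.mem_sphere] at hq
  have hqp : q ≠ p₀ := fun h => by
    rw [h, dist_self] at hq
    linarith
  have hgq : 0 < g q := hball (Metric.mem_ball.2 (by rw [hq]; linarith))
  set V : Set (Fin 2 → EuclideanSpace ℝ (Fin 3)) :=
    {x | x 0 ≠ x 1} ∩ ({x | 0 < g (x 0)} ∩ {x | 0 < g (x 1)}) with hV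
  have hVo : IsOpen V :=
    (isOpen_ne_fun (continuous_apply 0) (continuous_apply 1)).inter
      ((isOpen_lt continuous_const (g.continuous.comp (continuous_apply 0))).inter
        (isOpen_lt continuous_const (g.continuous.comp (continuous_apply 1))))
  have hVne : V.Nonempty := ⟨![q, p₀], by
    simp only [hV, Set.mem_inter_iff, Set.mem_setOf_eq, Matrix.cons_val_zero, Matrix.cons_val_one,
      Matrix.cons_val_fin_one]
    exact ⟨hqp, hgq, hp₀'⟩⟩
  have hVsub : V ⊆ Function.support (fun x : Fin 2 → EuclideanSpace ℝ (Fin 3) => S 2 x * ∏ i, g (x i)) := by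
    rintro x ⟨hne, h0, h1⟩
    rw [Function.mem_support]
    apply ne_of_gt
    rw [lowOrderClass_two_point_formula hnorm heuc hsc x, if_neg hne, Fin.prod_univ_two]
    have hn : 0 < ‖x 0 - x 1‖ := norm_pos_iff.2 (sub_ne_zero.2 hne)
    exact mul_pos (mul_pos hκ (Real.rpow_pos_of_pos hn _)) (mul_pos h0 h1)
  exact (hVo.measure_pos volume hVne).trans_le (measure_mono hVsub)

/-! ### Square integrability of the evaluations -/

/-- For `0 ≤ g ≢ 0` the second moment `∫ (ω g)² dμ = ∫ S 2 g⊗g > 0` is a NON-ZERO Bochner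
integral, hence a genuine one: `ω ↦ ω g` is in `L²(μ)`. [cite: GlimmJaffe1987, §6.1] -/
theorem lowOrderClass_memLp_of_nonneg {Δ : ℝ} {S : CorrFamily 3}
    {μ : Measure (FieldConfig (EuclideanSpace ℝ (Fin 3)))}
    (hnorm : ∀ n z, z ∉ NonCoincident 3 n → S n z = 0)
    (heuc : IsEuclideanInvariant S) (hsc : IsScaleCovariant Δ S)
    (hΔ0 : 0 ≤ Δ) (hΔ1 : Δ ≤ 1) (hκ : 0 < S 2 ![0, EuclideanSpace.single 0 1])
    (hmomS : HasMomentDensity μ S)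
    {g : SchwartzMap (EuclideanSpace ℝ (Fin 3)) ℝ} (hg0 : ∀ p, 0 ≤ g p)
    {p₀ : EuclideanSpace ℝ (Fin 3)} (hp₀ : g p₀ ≠ 0) :
    MemLp (fun ω : FieldConfig (EuclideanSpace ℝ (Fin 3)) => ω g) 2 μ := by
  have hpos := lowOrderClass_integral_pos hnorm heuc hsc hΔ0 hΔ1 hκ hg0 hp₀
  have h := hmomS 2 (fun _ => g)
  simp only [moment] at h
  have hne : (∫ ω : FieldConfig (EuclideanSpace ℝ (Fin 3)), ∏ _i : Fin 2, ω g ∂μ) ≠ 0 := by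
    rw [h]; exact hpos.ne'
  have hint : Integrable (fun ω : FieldConfig (EuclideanSpace ℝ (Fin 3)) => ∏ _i : Fin 2, ω g) μ := by
    by_contra hni
    exact hne (integral_undef hni)
  refine (memLp_two_iff_integrable_sq (measurable_eval g).aestronglyMeasurable).2 ?_
  refine hint.congr (Filter.Eventually.of_forall fun ω => ?_)
  simp only [Fin.prod_const]

/-- **(a) Square integrability** of `ω ↦ ω f` for every compactly supported test function `f`:
`f = (f + c•G) - c•G` with `G` a smooth bump equal to `1` on `tsupport f` and `c > sup |f|`, both
pieces being nonnegative and non-zero. [cite: GlimmJaffe1987, §6.1] -/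
theorem lowOrderClass_memLp {Δ : ℝ} {S : CorrFamily 3}
    {μ : Measure (FieldConfig (EuclideanSpace ℝ (Fin 3)))}
    (hnorm : ∀ n z, z ∉ NonCoincident 3 n → S n z = 0)
    (heuc : IsEuclideanInvariant S) (hsc : IsScaleCovariant Δ S)
    (hΔ0 : 0 ≤ Δ) (hΔ1 : Δ ≤ 1) (hκ : 0 < S 2 ![0, EuclideanSpace.single 0 1])
    (hmomS : HasMomentDensity μ S)
    (f : SchwartzMap (EuclideanSpace ℝ (Fin 3)) ℝ) (hf : HasCompactSupport f) :
    MemLp (fun ω : FieldConfig (EuclideanSpace ℝ (Fin 3)) => ω f) 2 μ := by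
  obtain ⟨R, hR0, hR⟩ := hf.isCompact.isBounded.subset_closedBall_lt 0 (0 : EuclideanSpace ℝ (Fin 3))
  obtain ⟨Cf, hCf⟩ := hf.exists_bound_of_continuous f.continuous
  let G : ContDiffBump (0 : EuclideanSpace ℝ (Fin 3)) := ⟨R, R + 1, hR0, by linarith⟩
  set Gs : SchwartzMap (EuclideanSpace ℝ (Fin 3)) ℝ := G.hasCompactSupport.toSchwartzMap G.contDiff
    with hGs
  have hGs_apply : ∀ x, Gs x = G x := fun x => rfl
  have hG1 : G 0 = 1 := G.one_of_mem_closedBall (Metric.mem_closedBall_self hR0.le)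
  set c : ℝ := |Cf| + 1 with hc
  have hc0 : 0 < c := by positivity
  have hfc : ∀ p, 0 < f p + c := fun p => by
    have h1 := hCf p
    rw [Real.norm_eq_abs] at h1
    have h2 := neg_abs_le (f p)
    have h3 := le_abs_self Cf
    linarith
  have hg₂0 : ∀ p, 0 ≤ (c • Gs) p := fun p => by
    rw [smul_apply, smul_eq_mul, hGs_apply]
    exact mul_nonneg hc0.le G.nonneg
  have hg₂ne : (c • Gs) 0 ≠ 0 := by
    rw [smul_apply, smul_eq_mul, hGs_apply, hG1, mul_one]
    exact hc0.ne'
  have hg₁0 : ∀ p, 0 ≤ (f + c • Gs) p := fun p => by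
    rw [add_apply, smul_apply, smul_eq_mul, hGs_apply]
    by_cases hp : p ∈ Metric.closedBall (0 : EuclideanSpace ℝ (Fin 3)) R
    · rw [G.one_of_mem_closedBall hp, mul_one]
      exact (hfc p).le
    · have hfp : f p = 0 := image_eq_zero_of_notMem_tsupport fun h => hp (hR h)
      rw [hfp, zero_add]
      exact mul_nonneg hc0.le G.nonneg
  have hg₁ne : (f + c • Gs) 0 ≠ 0 := by
    rw [add_apply, smul_apply, smul_eq_mul, hGs_apply, hG1, mul_one]
    exact (hfc 0).ne'
  have h₁ := lowOrderClass_memLp_of_nonneg hnorm heuc hsc hΔ0 hΔ1 hκ hmomS hg₁0 hg₁ne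
  have h₂ := lowOrderClass_memLp_of_nonneg hnorm heuc hsc hΔ0 hΔ1 hκ hmomS hg₂0 hg₂ne
  have heq : (fun ω : FieldConfig (EuclideanSpace ℝ (Fin 3)) => ω f) =
      fun ω => ω (f + c • Gs) - ω (c • Gs) := by
    funext ω
    rw [map_add]
    ring
  rw [heq]
  exact h₁.sub h₂

/-! ### First moments vanish, inverted second moments agree -/

/-- **(b) The law is centred on test functions**: `∫ ω f dμ = 0`, since `moment μ 1 ![f] = ∫ S 1 · f`
and `S 1 ≡ 0` for normalised limits of the critical correlators. [cite: AizenmanDuminilCopinSidoraviciusCMP2015, Thm. 1.2] -/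
theorem lowOrderClass_integral_eval_eq_zero {ρ : ℝ → ℝ} {S : CorrFamily 3}
    {μ : Measure (FieldConfig (EuclideanSpace ℝ (Fin 3)))}
    (hlim : HasPointwiseScalingLimit (criticalCorr 3) ρ S)
    (hnorm : ∀ n z, z ∉ NonCoincident 3 n → S n z = 0)
    (hmomS : HasMomentDensity μ S) (f : SchwartzMap (EuclideanSpace ℝ (Fin 3)) ℝ) :
    ∫ ω : FieldConfig (EuclideanSpace ℝ (Fin 3)), ω f ∂μ = 0 := by
  have h := hmomS 1 ![f]
  have hS1 : ∀ x, S 1 x = 0 := fun x => limit_odd_eq_zero hlim hnorm odd_one x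
  simp only [moment, Fin.prod_univ_one, Matrix.cons_val_zero, hS1, zero_mul, integral_zero] at h
  exact h

/-- Second moments through the density: `∫ (ω φ)² dμ = ∫ S 2 x φ(x₀) φ(x₁) dx` (both sides junk `0`
simultaneously). [cite: OsterwalderSchrader1973, §2] -/
theorem lowOrderClass_integral_sq_eq {S : CorrFamily 3}
    {μ : Measure (FieldConfig (EuclideanSpace ℝ (Fin 3)))}
    (hmomS : HasMomentDensity μ S) (φ : SchwartzMap (EuclideanSpace ℝ (Fin 3)) ℝ) :
    ∫ ω : FieldConfig (EuclideanSpace ℝ (Fin 3)), (ω φ) ^ 2 ∂μ =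
      ∫ x : Fin 2 → EuclideanSpace ℝ (Fin 3), S 2 x * ∏ i, φ (x i) := by
  have h := hmomS 2 (fun _ => φ)
  simp only [moment, Fin.prod_const] at h
  exact h

/-- **(c) Exact inverted second moments**: for `f` compactly supported off the origin,
`∫ (ω (ι^*_Δ f))² dμ = ∫ (ω f)² dμ` — change of variables under the unit sphere inversion
(`integral_sphereInversion_transfer`, `λ = 1`) and the two-point inversion law `invIdentity_two`.
[cite: FrancescoMathieuSenechal1997, §4.3.1 eq. (4.48)] -/
theorem lowOrderClass_inverted_sq {Δ : ℝ} {S : CorrFamily 3}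
    {μ : Measure (FieldConfig (EuclideanSpace ℝ (Fin 3)))}
    (hnorm : ∀ n z, z ∉ NonCoincident 3 n → S n z = 0)
    (heuc : IsEuclideanInvariant S) (hsc : IsScaleCovariant Δ S)
    (hmomS : HasMomentDensity μ S)
    (f : SchwartzMap (EuclideanSpace ℝ (Fin 3)) ℝ) (hf : HasCompactSupport f)
    (hft : tsupport (f : EuclideanSpace ℝ (Fin 3) → ℝ) ⊆ ({0} : Set (EuclideanSpace ℝ (Fin 3)))ᶜ) :
    ∫ ω : FieldConfig (EuclideanSpace ℝ (Fin 3)),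
        (ω (moebiusWeightedAction ConformalChart.unitInversion Δ f)) ^ 2 ∂μ =
      ∫ ω : FieldConfig (EuclideanSpace ℝ (Fin 3)), (ω f) ^ 2 ∂μ := by
  set g : SchwartzMap (EuclideanSpace ℝ (Fin 3)) ℝ :=
    moebiusWeightedAction ConformalChart.unitInversion Δ f with hg
  have hf0 : f 0 = 0 := image_eq_zero_of_notMem_tsupport fun h => hft h rfl
  have hg0 : g 0 = 0 :=
    moebiusWeightedAction_apply_of_not_mem f (by simp)
  have hinvs : ∀ y : EuclideanSpace ℝ (Fin 3),
      (1 / ‖y‖ ^ 2) • y = EuclideanGeometry.inversion 0 1 y := fun y => by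
    rw [sphereInversion_eq_smul_inversion 1 y, one_smul]
  have hgx : ∀ y : EuclideanSpace ℝ (Fin 3), y ≠ 0 →
      g y = (1 / ‖y‖ ^ 2) ^ ((3 : ℝ) - Δ) * f ((1 / ‖y‖ ^ 2) • y) := fun y hy => by
    rw [hg, moebiusWeightedAction_unitInversion_apply hf hft hy, finrank_euclideanSpace_fin,
      Nat.cast_ofNat, ← hinvs, one_div]
  rw [lowOrderClass_integral_sq_eq hmomS g, lowOrderClass_integral_sq_eq hmomS f]
  have key := integral_sphereInversion_transfer 2 1 one_pos Δ (S 2) (fun _ => ⇑f) (fun _ => hf0)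
  calc ∫ x : Fin 2 → EuclideanSpace ℝ (Fin 3), S 2 x * ∏ i, g (x i)
      = ∫ x : Fin 2 → EuclideanSpace ℝ (Fin 3),
          S 2 x * ∏ i, ((1 / ‖x i‖ ^ 2) ^ ((3 : ℝ) - Δ) * f ((1 / ‖x i‖ ^ 2) • x i)) := by
        congr 1
        funext x
        congr 1
        refine Finset.prod_congr rfl fun i _ => ?_
        by_cases hxi : x i = 0
        · rw [hxi, hg0, smul_zero, hf0, mul_zero]
        · exact hgx _ hxi
    _ = ∫ x : Fin 2 → EuclideanSpace ℝ (Fin 3),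
          (S 2 (fun i => (1 / ‖x i‖ ^ 2) • x i) * ∏ i, (1 / ‖x i‖ ^ 2) ^ Δ) * ∏ i, f (x i) := key
    _ = ∫ x : Fin 2 → EuclideanSpace ℝ (Fin 3), S 2 x * ∏ i, f (x i) := by
        congr 1
        funext x
        by_cases h0 : ∃ i, x i = 0
        · obtain ⟨i, hi⟩ := h0
          have hz : ∏ i, f (x i) = 0 := Finset.prod_eq_zero (Finset.mem_univ i) (by rw [hi, hf0])
          rw [hz, mul_zero, mul_zero]
        · push Not at h0
          have hinv := invIdentity_two hnorm heuc hsc x h0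
          have e1 : (fun i => (1 / ‖x i‖ ^ 2) • x i) =
              fun i => EuclideanGeometry.inversion 0 1 (x i) := funext fun i => hinvs (x i)
          have e2 : (∏ i, ‖x i‖ ^ (2 * Δ)) * ∏ i, (1 / ‖x i‖ ^ 2) ^ Δ = 1 := by
            rw [← Finset.prod_mul_distrib]
            refine Finset.prod_eq_one fun i _ => ?_
            have hn : 0 < ‖x i‖ := norm_pos_iff.2 (h0 i)
            rw [Real.rpow_mul hn.le, Real.rpow_two, ← Real.mul_rpow (by positivity) (by positivity),
              mul_one_div_cancel (by positivity), Real.one_rpow]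
          rw [e1, hinv]
          calc (∏ i, ‖x i‖ ^ (2 * Δ)) * S 2 x * (∏ i, (1 / ‖x i‖ ^ 2) ^ Δ) * ∏ i, f (x i)
              = ((∏ i, ‖x i‖ ^ (2 * Δ)) * ∏ i, (1 / ‖x i‖ ^ 2) ^ Δ) * (S 2 x * ∏ i, f (x i)) := by
                ring
            _ = S 2 x * ∏ i, f (x i) := by rw [e2, one_mul]

/-- Registered stub `stub_lowOrderClass` of crux `BallSpecifiedInversionUpgrade` (stmt-CriticalPhenomena-11248), line `birth` r2. -/
theorem stub_lowOrderClass :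
    ∀ (ρ : ℝ → ℝ) (Δ : ℝ) (S : Literature.Probability.LatticeModels.CorrFamily 3) (L : ℝ → ℕ) (μ : MeasureTheory.Measure (Literature.MathematicalPhysics.QuantumLattice.FieldConfig (EuclideanSpace ℝ (Fin 3)))) (γ : EuclideanSpace ℝ (Fin 3) → ℝ → Literature.MathematicalPhysics.QuantumLattice.FieldConfig (EuclideanSpace ℝ (Fin 3)) → MeasureTheory.Measure (Literature.MathematicalPhysics.QuantumLattice.FieldConfig (EuclideanSpace ℝ (Fin 3)))), ((∀ δ ∈ Set.Ioc (0:ℝ) 1, 0 < ρ δ) ∧ 0 < Δ ∧ Literature.Probability.LatticeModels.HasPointwiseScalingLimit (Literature.Probability.LatticeModels.criticalCorr 3) ρ S ∧ (∀ n z, z ∉ Literature.Probability.LatticeModels.NonCoincident 3 n → S n z = 0) ∧ Literature.Probability.LatticeModels.IsNondegenerateTwoPoint S ∧ Literature.Probability.LatticeModels.IsEuclideanInvariant S ∧ Literature.Probability.LatticeModels.IsScaleCovariant Δ S ∧ Filter.Tendsto (fun δ : ℝ => δ * L δ) (nhdsWithin 0 (Set.Ioi 0)) Filter.atTop ∧ Literature.MathematicalPhysics.QuantumLattice.TendstoInLaw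 (fun δ => Literature.MathematicalPhysics.QuantumLattice.spinFieldLaw (Literature.Probability.LatticeModels.isingMeasure (Literature.Probability.LatticeModels.zdGraph 3) (Literature.Probability.LatticeModels.box 3 (L δ)) (Literature.Probability.LatticeModels.criticalBeta 3) 0 Literature.Probability.LatticeModels.BoundaryCondition.plus) (Literature.Probability.LatticeModels.box 3 (L δ)) δ (ρ δ)) (nhdsWithin 0 (Set.Ioi 0)) μ ∧ Literature.MathematicalPhysics.QuantumLattice.HasMomentDensity μ S ∧ Literature.MathematicalPhysics.QuantumLattice.IsEuclideanInvariantLaw μ ∧ (∀ (s : ℝ) (hs : 0 < s), MeasureTheory.Measure.map (Literature.MathematicalPhysics.QuantumLattice.FieldConfig.act ((s ^ (Δ - 3)) • Literature.MathematicalPhysics.QuantumLattice.dilateTest s hs.ne')) μ = μ) ∧ (∀ c r, 0 < r → ∀ η, MeasureTheory.IsProbabilityMeasure (γ c r η)) ∧ (∀ c r, 0 < r → ∀ A, MeasurableSet A → Measurable[Literature.MathematicalPhysics.QuantumLattice.extEvents (Metric.closedBall c r)ᶜ] (fun η => γ c r η A)) ∧ (∀ c r, 0 < r → ∀ A, MeasurableSet[Literature.MathematicalPhysics.QuantumLattice.extEvents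 (Metric.ball c r)] A → Measurable[Literature.MathematicalPhysics.QuantumLattice.germEvents c r] (fun η => γ c r η A)) ∧ (∀ c r, 0 < r → ∀ η, ∀ᵐ ω ∂(γ c r η), ∀ f : SchwartzMap (EuclideanSpace ℝ (Fin 3)) ℝ, tsupport (f : EuclideanSpace ℝ (Fin 3) → ℝ) ⊆ (Metric.closedBall c r)ᶜ → ω f = η f) ∧ Literature.MathematicalPhysics.QuantumLattice.IsGibbsFor γ μ Set.univ) → (∀ f : SchwartzMap (EuclideanSpace ℝ (Fin 3)) ℝ, HasCompactSupport (f : EuclideanSpace ℝ (Fin 3) → ℝ) → MeasureTheory.MemLp (fun ω : Literature.MathematicalPhysics.QuantumLattice.FieldConfig (EuclideanSpace ℝ (Fin 3)) => ω f) 2 μ) ∧ (∀ f : SchwartzMap (EuclideanSpace ℝ (Fin 3)) ℝ, ∫ ω, ω f ∂μ = 0) ∧ (∀ f : SchwartzMap (EuclideanSpace ℝ (Fin 3)) ℝ, HasCompactSupport (f : EuclideanSpace ℝ (Fin 3) → ℝ) → tsupport (f : EuclideanSpace ℝ (Fin 3) → ℝ) ⊆ (({0} : Set (EuclideanSpace ℝ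 (Fin 3)))ᶜ) → ∫ ω, (ω (Literature.Probability.LatticeModels.moebiusWeightedAction Literature.Probability.LatticeModels.ConformalChart.unitInversion Δ f)) ^ 2 ∂μ = ∫ ω, (ω f) ^ 2 ∂μ) := by
  intro ρ Δ S L μ γ hH
  obtain ⟨hρ, -, hlim, hnorm, hnd, heuc, hsc, -, -, hmomS, -⟩ := hH
  have hwin := delta_mem_Icc_of_hyp hρ hlim hnd hsc
  have hΔ0 : 0 ≤ Δ := by linarith [hwin.1]
  have hκ : 0 < S 2 ![0, EuclideanSpace.single 0 1] :=
    hnd _ (zero_unitVec_mem_nonCoincident one_ne_zero)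
  exact ⟨fun f hf => lowOrderClass_memLp hnorm heuc hsc hΔ0 hwin.2 hκ hmomS f hf,
    fun f => lowOrderClass_integral_eval_eq_zero hlim hnorm hmomS f,
    fun f hf hft => lowOrderClass_inverted_sq hnorm heuc hsc hmomS f hf hft⟩

end Summit.CriticalPhenomena.Ising3DConformalLimit.BallSpecificationBallSpecifiedInversionUpgrade

end
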